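import Summits.Ventures.HSemireg.WedgeHankelRecurrenceGaussZerosExtremeOffDiagonal

/-!
# Venture HSemireg — **TRACE IDENTITIES FOR THE REPRODUCING KERNEL**: `Σ_l ν_l K_n(w_l, w_l) = n + 1` (the kernel is a projection of rank `n + 1`, so the reciprocal Christoffel function
# integrates to the dimension), `Σ_l ν_l w_l K_n(w_l, w_l) = a_0 + ⋯ + a_n` (the trace of the compressed multiplication operator — the Jacobi matrix), which is also the sum of the zeros of
# `q_{n+1}`; at the Gauss nodes `Σ_k μ_k K_t(x_k, x_k) = t + 1` term by term

HONEST FRAMING. Part of the Lean index of the computation cell `pub-hsemireg` (seat p10 gen 44, Sunday typer «UNIFORM-IN-n»).  Finite sums and real polynomials only; no variety, no cohomology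
theory, no sheaf, no Ext group and no semiregularity map is constructed here; nothing here says that HC / HC_CM / HC_AV holds; no Literature fact (unproved `Prop`) is declared or used.  Custodian
versions as in `WedgeHankelSiegelIdeal` (1/3).
SOURCES (cited).  G. Szegő, *Orthogonal Polynomials*, §3.1 (3.1.9)–(3.1.10) (the kernel as the reproducing projection); P. Nevai, *Géza Freud, orthogonal polynomials and Christoffel functions*,
J. Approx. Theory 48 (1986) §4.1 (`∫ K_n(x,x) dα = n + 1`); B. Simon, *Szegő's Theorem and its Descendants* (2011) §1.2 (trace of the truncated Jacobi matrix).
PROOF TYPED HERE.  Exchange of the two finite sums; `Σ_l ν_l q_k(w_l)² = h_k` and N303 `a_k h_k = Σ_l ν_l w_l q_k(w_l)²`; N298 `sum_recurrence_zeros` for the zeros.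
DEDUP DISCLOSURE (`rg -n 'kernel_trace|sum_mul_kernel_diag|trace' Summits/Ventures/HSemireg`, 2026-09-03): N298 `trace_jacobi` is the matrix trace `Σ a_i`; N277 `gauss_weight_mul_kernel_diag_eq_one`
gives `μ_k K_t(x_k, x_k) = 1`; the measure-side trace identities are new.  The 4 names below: 0 hits tree-wide.

WHAT IS IN THE TREE.  N303 `a_mul_norm_eq_sum_mul_node_mul_sq`; N298 `sum_recurrence_zeros`; N277 `gauss_weight_mul_kernel_diag_eq_one`.
THIS FILE (namespace `Summit.Ventures.HSemireg.Wedge.HankelOuter` continued; CHAINED on N325 (import only), N277, N298, N303; 0 definitions):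
* §1091 **`sum_mul_kernel_diag_eq_card`** (`Σ_l ν_l Σ_{k≤n} q_k(w_l)²∕h_k = n + 1`), **`sum_mul_node_mul_kernel_diag_eq_sum_a`** (`Σ_l ν_l w_l K_n(w_l,w_l) = Σ_{k≤n} a_k`),
  `sum_mul_node_mul_kernel_diag_eq_sum_zeros` (`= Σ` zeros of `q_{n+1}`), `sum_gauss_weight_mul_kernel_diag` (`Σ_k μ_k K_t(x_k,x_k) = t + 1`).
CAVEATS.  Discrete measures with `h_k ≠ 0` (`k ≤ n`).  Nothing Ext-side.  New names only.
-/

open Module Polynomial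
open scoped Matrix Polynomial

namespace Summit.Ventures.HSemireg.Wedge.HankelOuter

/-! ## §1091. Trace identities for the reproducing kernel -/

/-- **`Σ_l ν_l K_n(w_l, w_l) = n + 1`**: the reciprocal of the Christoffel function integrates to the dimension of the polynomial space (`h_k = Σ_l ν_l q_k(w_l)² ≠ 0`, `k ≤ n`).
[Szegő (3.1.9); Nevai 1986 §4.1; this file, §1091] -/
theorem sum_mul_kernel_diag_eq_card {N n : ℕ} {ν w : Fin N → ℝ} {q : ℕ → ℝ[X]} (hh : ∀ k, k ≤ n → ∑ l, ν l * ((q k).eval (w l)) ^ 2 ≠ 0) :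
    ∑ l, ν l * ∑ k ∈ Finset.range (n + 1), ((q k).eval (w l)) ^ 2 / ∑ l', ν l' * ((q k).eval (w l')) ^ 2 = (n : ℝ) + 1 := by
  simp_rw [Finset.mul_sum]
  rw [Finset.sum_comm]
  have hk : ∀ k ∈ Finset.range (n + 1), ∑ l, ν l * (((q k).eval (w l)) ^ 2 / ∑ l', ν l' * ((q k).eval (w l')) ^ 2) = 1 := fun k hk => by
    simp_rw [mul_div_assoc', ← Finset.sum_div]
    exact div_self (hh k (Nat.lt_succ_iff.1 (Finset.mem_range.1 hk)))
  rw [Finset.sum_congr rfl hk, Finset.sum_const, Finset.card_range, nsmul_eq_mul, mul_one, Nat.cast_add, Nat.cast_one]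

/-- **`Σ_l ν_l w_l K_n(w_l, w_l) = a_0 + ⋯ + a_n`**: the trace of multiplication by `x` compressed to the polynomials of degree `≤ n` (the `(n+1) × (n+1)` Jacobi matrix, N298 `trace_jacobi`).
[Simon 2011 §1.2; this file, §1091] -/
theorem sum_mul_node_mul_kernel_diag_eq_sum_a {N n : ℕ} {ν w : Fin N → ℝ} {q : ℕ → ℝ[X]} {a b : ℕ → ℝ} (hq0 : q 0 = 1) (hq1 : q 1 = Polynomial.X - C (a 0))
    (hrec : ∀ n, q (n + 2) = (Polynomial.X - C (a (n + 1))) * q (n + 1) - C (b (n + 1)) * q n)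
    (horth : ∀ k, k ≤ n + 1 → ∀ G : ℝ[X], G.natDegree < k → ∑ l, ν l * (q k * G).eval (w l) = 0) (hh : ∀ k, k ≤ n → ∑ l, ν l * ((q k).eval (w l)) ^ 2 ≠ 0) :
    ∑ l, ν l * (w l * ∑ k ∈ Finset.range (n + 1), ((q k).eval (w l)) ^ 2 / ∑ l', ν l' * ((q k).eval (w l')) ^ 2) = ∑ k ∈ Finset.range (n + 1), a k := by
  simp_rw [Finset.mul_sum]
  rw [Finset.sum_comm]
  refine Finset.sum_congr rfl fun k hk => ?_
  have hk' : k ≤ n := Nat.lt_succ_iff.1 (Finset.mem_range.1 hk)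
  have hl : ∀ l, ν l * (w l * (((q k).eval (w l)) ^ 2 / ∑ l', ν l' * ((q k).eval (w l')) ^ 2)) = ν l * (w l * ((q k).eval (w l)) ^ 2) / ∑ l', ν l' * ((q k).eval (w l')) ^ 2 :=
    fun l => by ring
  rw [Finset.sum_congr rfl fun l _ => hl l, ← Finset.sum_div, ← a_mul_norm_eq_sum_mul_node_mul_sq hq0 hq1 hrec k (fun j hj => horth j (by omega)), mul_div_assoc,
    div_self (hh k hk'), mul_one]

/-- **`Σ_l ν_l w_l K_n(w_l, w_l)` is the sum of the zeros of `q_{n+1}`** (N298: `Σ zeros = Σ_{k≤n} a_k`). [this file, §1091] -/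
theorem sum_mul_node_mul_kernel_diag_eq_sum_zeros {N n : ℕ} {ν w : Fin N → ℝ} {q : ℕ → ℝ[X]} {a b : ℕ → ℝ} (hq0 : q 0 = 1) (hq1 : q 1 = Polynomial.X - C (a 0))
    (hrec : ∀ n, q (n + 2) = (Polynomial.X - C (a (n + 1))) * q (n + 1) - C (b (n + 1)) * q n)
    (horth : ∀ k, k ≤ n + 1 → ∀ G : ℝ[X], G.natDegree < k → ∑ l, ν l * (q k * G).eval (w l) = 0) (hh : ∀ k, k ≤ n → ∑ l, ν l * ((q k).eval (w l)) ^ 2 ≠ 0)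
    {z : Fin (n + 1) → ℝ} (hz : q (n + 1) = ∏ k, (Polynomial.X - C (z k))) :
    ∑ l, ν l * (w l * ∑ k ∈ Finset.range (n + 1), ((q k).eval (w l)) ^ 2 / ∑ l', ν l' * ((q k).eval (w l')) ^ 2) = ∑ k, z k := by
  rw [sum_mul_node_mul_kernel_diag_eq_sum_a hq0 hq1 hrec horth hh, sum_recurrence_zeros hq0 hq1 hrec hz]

/-- **At the Gauss nodes: `Σ_k μ_k K_t(x_k, x_k) = t + 1`** (each term is `1`, N277). [this file, §1091] -/
theorem sum_gauss_weight_mul_kernel_diag {N t : ℕ} {ν w : Fin N → ℝ} {q : ℕ → ℝ[X]} (hmonic : ∀ k, k ≤ t → (q k).Monic) (hdeg : ∀ k, k ≤ t → (q k).natDegree = k)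
    (horth : ∀ k, k ≤ t → ∀ G : ℝ[X], G.natDegree < k → ∑ l, ν l * (q k * G).eval (w l) = 0) (hh : ∀ k, k ≤ t → ∑ l, ν l * ((q k).eval (w l)) ^ 2 ≠ 0)
    {μ x : Fin (t + 1) → ℝ} (hx : Function.Injective x) (hmom : ∀ p, p ≤ 2 * t → ∑ j, μ j * x j ^ p = ∑ l, ν l * w l ^ p) :
    ∑ k, μ k * ∑ j ∈ Finset.range (t + 1), ((q j).eval (x k)) ^ 2 / ∑ l, ν l * ((q j).eval (w l)) ^ 2 = (t : ℝ) + 1 := by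
  rw [Finset.sum_congr rfl fun k _ => gauss_weight_mul_kernel_diag_eq_one hmonic hdeg horth hh hx hmom k, Finset.sum_const, Finset.card_univ, Fintype.card_fin,
    nsmul_eq_mul, mul_one, Nat.cast_add, Nat.cast_one]

end Summit.Ventures.HSemireg.Wedge.HankelOuter
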